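import Summits.QuantumFields.QCD.Theorems.NestedDissectionSeaCoerciveOfDilute
import Summits.QuantumFields.QCD.Theorems.NestedDissectionSeaCoerciveSeaAchiralPileupRareOneSite

/-!
# Route `NestedDissectionSea`, support `CoerciveOfDilute` (stmt-QuantumFields-14759) —
# the subsequence freedom of the `∃`-alignment, and the exact one-site exposure of clause (i)

Two sorry-free additions to the reduction file `NestedDissectionSeaCoerciveOfDilute.lean`
(`coerciveOfDilute_of_separatorWegnerLaw`: the separator Wegner law (i) along the dilution-certified
regularisation, eventually in `k`, closes the glue item `CoerciveOfDilute : NegativeCellsDilute →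
CoerciveSea`).

* `coerciveOfDilute_of_subseqWegnerLaw` — THE WEAKEST SAME-TRAJECTORY RESIDUAL. Admissibility
  (`HasMassScaling`, `HasAsymptoticScaling`, `a_k → 0`, `a_k L_k → ∞`) and the two clauses (ii)
  windowed dilution, (iii) parity pin of `NegativeCellsDilute` are limit / `∀ᶠ k` statements, hence
  pass to `reg ∘ φ` for EVERY `φ : ℕ → ℕ` tending to infinity; the hinge asks for ONE regularisation.
  So it suffices to prove clause (i) along SOME subsequence of the certified regularisation (chosen
  once, before the mass tuple), with all the freedoms of the earlier reduction (threshold `M₁`, window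
  `ℓ₁`, per-tuple `R, C, α`, levels `t ≤ t₀`). "Eventually in `k`" in the residual becomes "along a
  subsequence": the glue needs (i) only FREQUENTLY-and-robustly, not cofinally.
* `hasSingularSeparator_oneSiteBox_iff` — on the one-site box `s = (2,2,2,2)` (in the window iff
  `b₀ = 2`) the event of clause (i) does not see the gauge field: `HasSingularSeparator U μ (2,2,2,2) τ
  ↔ |μ + 4| < |τ|` (the cell is `(μ+4)·1`, `wilsonCell_oneSiteBox`; its children interior is empty).
* `separatorLaw_false_of_pin_of_cluster_neg_four` — THE EXPOSURE, EXACT. If the pin (iii) holds for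
  `(reg, M₀, m, R)` and `−4` is a cluster value of `mcrit` (`∀ η > 0, ∃ᶠ k, |mcrit k + 4| < η`), then
  clause (i) at leaf size `b₀ = 2` FAILS for `(reg, ℓ, m, R)` with every `C` and every `α > 0`
  (`reg` with `HasMassScaling`, `N_f ≤ 16`): the valence offsets `a_k m_f/Z_m k → 0`
  (`tendsto_a_div_Zm`) and the pin makes the phase-quenched normaliser non-zero, so at a `k` with `|m_f(k) + 4| < t/2` the one-site event is
  certain and its ratio is `1 > C t^α`. Consequently the same-trajectory residual can only hold
  along subsequences keeping the sea masses off `−4`; if `b₀ = 2` and `mcrit k → −4` along the whole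
  certified sequence (the central doubler branch — not excluded by (ii)+(iii) as typed, excluded by
  the physical-branch clause `m_f(k) > −1` of `IsQCDAlong` in the summit statement), no subsequence
  serves and the item needs `CoerciveSea` outright. Recommended guard (planner): carry
  `∀ᶠ k, −1 < reg.mcrit k` in the shared prefix of the cruxes, as `QCDOf` demands anyway.

Standard material; no Theses statement is asserted. [folklore]
-/

noncomputable section

open scoped BigOperators Classical
open MeasureTheory Filter Matrix
open Literature.MathematicalPhysics.QuantumLattice Literature.MathematicalPhysics.QuantumFieldTheory
  Literature.Probability.LatticeModels
open Summit.QuantumFields.QCD.Theses.NestedDissectionSea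
open Summit.QuantumFields.QCD.Theorems.CoerciveSeaNegative
open Summit.QuantumFields.QCD.Cruxes.CoerciveSea.ChiralityCollapsesPseudospectrum
  (wilsonCell_oneSiteBox not_childrenInterior_oneSiteBox)

namespace Summit.QuantumFields.QCD.Theorems.NestedDissectionSeaCoerciveOfDilute

/-! ## 1. The one-site box: clause (i)'s event is gauge-blind there -/

section OneSite

variable {N : ℕ} [NeZero N]

/-- **The one-site separator event.** On the corner-`0` box of sides `(2,2,2,2)` of a torus of side
`N ≥ 2` (one site, twelve indices, empty children interior) and for every `SU(3)` gauge field,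
`HasSingularSeparator U μ (2,2,2,2) τ ↔ |μ + 4| < |τ|`: the Dirichlet cell is `(μ + 4)·1`
(`wilsonCell_oneSiteBox`), so every non-zero vector is "harmonic" (vacuously) with separator residual
exactly `|μ + 4|` times its separator mass (the event is even in `τ`). [folklore] -/
theorem hasSingularSeparator_oneSiteBox_iff (hN : 2 ≤ N)
    (U : GaugeConfig 4 N (Matrix.specialUnitaryGroup (Fin 3) ℂ)) (μ τ : ℝ) :
    HasSingularSeparator U μ (fun _ => 2) τ ↔ |μ + 4| < |τ| := by
  haveI : Fact (1 < N) := ⟨hN⟩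
  -- the cell acts as the scalar `μ + 4`
  have hnorm : ∀ (w : {p // wilsonBox (0 : TorusSite 4 N) (fun _ => 2) p} → ℂ) p,
      ‖(wilsonCell U μ 0 (fun _ => 2)).mulVec w p‖ ^ 2 = (μ + 4) ^ 2 * ‖w p‖ ^ 2 := by
    intro w p
    rw [wilsonCell_oneSiteBox, Matrix.smul_mulVec, Matrix.one_mulVec, Pi.smul_apply, smul_eq_mul,
      norm_mul, Complex.norm_real, Real.norm_eq_abs, mul_pow, sq_abs]
  -- the two separator sums, with the (empty) children interior removed
  have hsumL : ∀ w : {p // wilsonBox (0 : TorusSite 4 N) (fun _ => 2) p} → ℂ,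
      (∑ p, (if childrenInterior (fun _ => (2 : ℕ)) p then (0 : ℝ)
        else ‖(wilsonCell U μ 0 (fun _ => 2)).mulVec w p‖ ^ 2)) = (μ + 4) ^ 2 * ∑ p, ‖w p‖ ^ 2 := by
    intro w
    rw [Finset.mul_sum]
    refine Finset.sum_congr rfl fun p _ => ?_
    rw [if_neg (not_childrenInterior_oneSiteBox p), hnorm]
  have hsumR : ∀ w : {p // wilsonBox (0 : TorusSite 4 N) (fun _ => 2) p} → ℂ,
      (∑ p, (if childrenInterior (fun _ => (2 : ℕ)) p then (0 : ℝ) else ‖w p‖ ^ 2)) = ∑ p, ‖w p‖ ^ 2 :=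
    fun w => Finset.sum_congr rfl fun p _ => by rw [if_neg (not_childrenInterior_oneSiteBox p)]
  constructor
  · rintro ⟨w, ⟨p₀, -, hp₀⟩, -, hres⟩
    rw [hsumL, hsumR] at hres
    have hS : 0 < ∑ p, ‖w p‖ ^ 2 :=
      lt_of_lt_of_le (by positivity : (0 : ℝ) < ‖w p₀‖ ^ 2)
        (Finset.single_le_sum (f := fun p => ‖w p‖ ^ 2) (fun p _ => by positivity) (Finset.mem_univ p₀))
    exact sq_lt_sq.mp (lt_of_mul_lt_mul_right hres hS.le)
  · intro hμ
    -- the constant vector `1` on the (non-empty) box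
    have hbox : wilsonBox (0 : TorusSite 4 N) (fun _ => 2)
        ((fun _ => (1 : ZMod N)), (0 : Fin 3), (0 : Fin 4)) := by
      intro i
      simp [ZMod.val_one]
    let p₀ : {p // wilsonBox (0 : TorusSite 4 N) (fun _ => 2) p} :=
      ⟨((fun _ => (1 : ZMod N)), (0 : Fin 3), (0 : Fin 4)), hbox⟩
    refine ⟨fun _ => 1, ⟨p₀, not_childrenInterior_oneSiteBox p₀, one_ne_zero⟩,
      fun p hp => (not_childrenInterior_oneSiteBox p hp).elim, ?_⟩
    rw [hsumL, hsumR]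
    have hS : 0 < ∑ p : {p // wilsonBox (0 : TorusSite 4 N) (fun _ => 2) p}, ‖((fun _ => (1 : ℂ)) p)‖ ^ 2 :=
      lt_of_lt_of_le (by norm_num : (0 : ℝ) < ‖(1 : ℂ)‖ ^ 2)
        (Finset.single_le_sum (f := fun p => ‖((fun _ => (1 : ℂ)) p)‖ ^ 2) (fun p _ => by positivity)
          (Finset.mem_univ p₀))
    exact mul_lt_mul_of_pos_right (sq_lt_sq.mpr hμ) hS

/-- **A margin off `−4` neutralises the one-site box.** If the cell mass keeps a margin
`η ≤ |μ + 4|` then at every level `τ` with `|τ| ≤ η` the one-site box `(2,2,2,2)` carries NO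
`τ`-singular separator, for every gauge field (so its phase-quenched probability in clause (i) is
`0` at all levels `t/2 ≤ η`): the guard recommended to the planner, read on this box. [folklore] -/
theorem not_hasSingularSeparator_oneSiteBox_of_margin (hN : 2 ≤ N)
    (U : GaugeConfig 4 N (Matrix.specialUnitaryGroup (Fin 3) ℂ)) {μ τ η : ℝ} (hη : η ≤ |μ + 4|)
    (hτ : |τ| ≤ η) : ¬ HasSingularSeparator U μ (fun _ => 2) τ := fun h =>
  absurd ((hasSingularSeparator_oneSiteBox_iff hN U μ τ).mp h) (not_lt.mpr (hτ.trans hη))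

end OneSite

/-! ## 2. A certain event has phase-quenched ratio one -/

section Ratio

variable {Ω : Type*} [MeasurableSpace Ω]

/-- The phase-quenched ratio `(∫ 1_E · wt) / (∫ wt)` of an event that holds for EVERY configuration
equals `1` as soon as the normaliser is non-zero. [folklore] -/
theorem quenchedRatio_eq_one_of_forall (μ : Measure Ω) (wt : Ω → ℝ) {E : Ω → Prop} (hE : ∀ U, E U)
    (hZ : ∫ U, wt U ∂μ ≠ 0) :
    (∫ U, (if E U then (1 : ℝ) else 0) * wt U ∂μ) / (∫ U, wt U ∂μ) = 1 := by
  have h : (fun U => (if E U then (1 : ℝ) else 0) * wt U) = wt :=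
    funext fun U => by rw [if_pos (hE U), one_mul]
  rw [h]
  exact div_self hZ

end Ratio

/-! ## 3. The exposure: the pin and a critical mass clustering at `−4` kill clause (i) at leaf size `2` -/

/-- **Clause (i) at `b₀ = 2` fails along a pinned regularisation whose critical mass clusters at
`−4`.** Let the pin clause (iii) hold for `(reg, M₀, m, R)` (VERBATIM, `PinClause`) and let `−4` be a
cluster value of `reg.mcrit` (`∀ η > 0, ∃ᶠ k, |mcrit k + 4| < η`). Then for every window `ℓ > 0`,
every `C` and every `α > 0` the separator Wegner law (i) of `CoerciveSea` with leaf size `2` — VERBATIM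
its clause for the data `(reg, b₀ := 2, ℓ, m, R, C, α)` — is FALSE (for `N_f ≤ 16` and `reg` with
`HasMassScaling`, as every admissible regularisation has; the pin alone would do, via
`PinClause.tendsto_valenceOffset` of `PinSelfSufficiency.lean`). Proof: choose `t ∈ (0,1]` with
`C t^α ≤ 1/2`; `a_k m_f/Z_m k → 0` (`tendsto_a_div_Zm`), so frequently
`|m_f(k) + 4| < t/2` together with the pin at depth `M₀ + 1`, `2 a_k ≤ ℓ` and the purported law; on a
torus of physical side `≥ R` with `≥ 3` sites the one-site box `(2,2,2,2)` is an admissible roughly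
cubic window box, its event `HasSingularSeparator U m_f(k) (2,2,2,2) (t/2)` holds for EVERY field
(`hasSingularSeparator_oneSiteBox_iff`), the pin ratio `≥ 1/4` forces the normaliser `≠ 0`, so the
ratio is `1 ≤ C t^α ≤ 1/2`. Hence the same-trajectory residual of `CoerciveOfDilute`
(`coerciveOfDilute_of_subseqWegnerLaw`) can only hold along subsequences keeping `mcrit` off `−4`
when `b₀ = 2`. [folklore] -/
theorem separatorLaw_false_of_pin_of_cluster_neg_four {Nf : ℕ} {reg : QCDRegularisation Nf}
    {M₀ : ℝ} {m : Fin Nf → ℝ} {R : ℝ} (hpin : PinClause Nf reg M₀ m R)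
    (h4 : ∀ η : ℝ, 0 < η → ∃ᶠ k : ℕ in Filter.atTop, |reg.mcrit k + 4| < η)
    (hNf : Nf ≤ 16) (hms : reg.HasMassScaling) (f₀ : Fin Nf) {ℓ : ℝ} (hℓ : 0 < ℓ) (C α : ℝ)
    (hα : 0 < α) :
    ¬ (∀ᶠ k : ℕ in Filter.atTop, ∀ S : ℕ, R ≤ reg.a k * (2 * S + 1) →
        let N : ℕ := 2 * S + 1
        let mq : Fin Nf → ℝ := fun f => reg.mcrit k + reg.a k * m f / reg.Zm k
        let wt : GaugeConfig 4 N (Matrix.specialUnitaryGroup (Fin 3) ℂ) → ℝ := fun U =>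
          ∏ f, ‖fermionDet (wilsonDirac (fundamentalRep (Fin 3)) U (mq f) 1)‖
        let P : (GaugeConfig 4 N (Matrix.specialUnitaryGroup (Fin 3) ℂ) → Prop) → ℝ := fun E =>
          (∫ U, (if E U then (1 : ℝ) else 0) * wt U
              ∂(wilsonMeasure (d := 4) (L := N) (fundamentalRep (Fin 3)) (reg.β k))) /
            (∫ U, wt U ∂(wilsonMeasure (d := 4) (L := N) (fundamentalRep (Fin 3)) (reg.β k)))
        ∀ s : Fin 4 → ℕ, (∀ i, 2 ≤ s i ∧ s i ≤ N ∧ (s i : ℝ) * reg.a k ≤ ℓ) →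
          (∀ i j, s i ≤ 2 * s j) → ∀ f : Fin Nf, ∀ t : ℝ, 0 < t → t ≤ 1 →
            P (fun U => HasSingularSeparator U (mq f) s (t / s 0)) ≤ C * t ^ α) := by
  intro hlaw
  -- a level `t ∈ (0,1]` with `C t^α ≤ 1/2`
  set c : ℝ := max C 1 with hc
  have hc1 : 1 ≤ c := le_max_right _ _
  have hbase : 0 < 1 / (2 * c) := by positivity
  have hbase1 : 1 / (2 * c) ≤ 1 := by
    rw [div_le_one (by positivity)]
    linarith
  set t : ℝ := (1 / (2 * c)) ^ α⁻¹ with ht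
  have ht0 : 0 < t := Real.rpow_pos_of_pos hbase _
  have ht1 : t ≤ 1 := Real.rpow_le_one hbase.le hbase1 (inv_nonneg.mpr hα.le)
  have htα : t ^ α = 1 / (2 * c) := by rw [ht, Real.rpow_inv_rpow hbase.le hα.ne']
  have hCt : C * t ^ α ≤ 1 / 2 := by
    rw [htα]
    calc C * (1 / (2 * c)) ≤ c * (1 / (2 * c)) :=
          mul_le_mul_of_nonneg_right (le_max_left _ _) hbase.le
      _ = 1 / 2 := by field_simp
  -- eventually in `k`: small valence offset, the leaf inside the window, the pin at depth `M₀ + 1`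
  have hoff : Filter.Tendsto (fun k => reg.a k * m f₀ / reg.Zm k) Filter.atTop (nhds 0) := by
    have h := (tendsto_a_div_Zm reg hms (massExponent_pos hNf)).mul_const (m f₀)
    rw [zero_mul] at h
    exact h.congr fun k => by ring
  have h1 : ∀ᶠ k : ℕ in Filter.atTop, reg.a k * m f₀ / reg.Zm k < t / 4 :=
    (tendsto_order.mp hoff).2 _ (by positivity)
  have h2 : ∀ᶠ k : ℕ in Filter.atTop, -(t / 4) < reg.a k * m f₀ / reg.Zm k :=
    (tendsto_order.mp hoff).1 _ (by linarith)
  have hwin : ∀ᶠ k : ℕ in Filter.atTop, reg.a k < ℓ / 2 :=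
    reg.tendsto_a.eventually (gt_mem_nhds (by positivity))
  have hall := (hpin (M₀ + 1) (by linarith)).and ((h1.and h2).and (hwin.and hlaw))
  obtain ⟨k, hk4, hkpin, ⟨hk1, hk2⟩, hkwin, hklaw⟩ := ((h4 (t / 4) (by positivity)).and_eventually hall).exists
  -- a torus of physical side `≥ R` with at least three sites per direction
  obtain ⟨S₀, hS₀⟩ := exists_torus_ge reg k R
  have ha := reg.a_pos k
  have hS : R ≤ reg.a k * (2 * ((S₀ + 1 : ℕ) : ℝ) + 1) := by
    push_cast
    nlinarith
  have hkpinS := hkpin (S₀ + 1) hS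
  have hklawS := hklaw (S₀ + 1) hS
  dsimp only at hkpinS hklawS
  -- the normaliser is non-zero (else the pin ratio would be `0 < 1/4`)
  have hZ : (∫ U, ∏ f, ‖fermionDet (wilsonDirac (fundamentalRep (Fin 3)) U
      (reg.mcrit k + reg.a k * m f / reg.Zm k) 1)‖
        ∂(wilsonMeasure (d := 4) (L := 2 * (S₀ + 1) + 1) (fundamentalRep (Fin 3)) (reg.β k))) ≠ 0 := by
    intro h0
    rw [h0, div_zero] at hkpinS
    norm_num at hkpinS
  -- the sea mass of flavour `f₀` is within `t/2` of `−4`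
  have hμ : |reg.mcrit k + reg.a k * m f₀ / reg.Zm k + 4| < t / 2 := by
    have h4' := abs_lt.mp hk4
    rw [abs_lt]
    constructor <;> linarith [h4'.1, h4'.2]
  -- the one-site box is an admissible roughly cubic window box, and its event is certain
  have hN : 2 ≤ 2 * (S₀ + 1) + 1 := by omega
  have hbox := hklawS (fun _ => 2) (fun i => ⟨le_rfl, hN, by push_cast; linarith⟩)
    (fun i j => by norm_num) f₀ t ht0 ht1
  have hev : ∀ U : GaugeConfig 4 (2 * (S₀ + 1) + 1) (Matrix.specialUnitaryGroup (Fin 3) ℂ),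
      HasSingularSeparator U (reg.mcrit k + reg.a k * m f₀ / reg.Zm k) (fun _ => 2)
        (t / ((2 : ℕ) : ℝ)) := fun U =>
    (hasSingularSeparator_oneSiteBox_iff hN U _ _).mpr (hμ.trans_le (by
      rw [Nat.cast_ofNat, abs_of_pos (by positivity)]))
  rw [quenchedRatio_eq_one_of_forall _ _ hev hZ] at hbox
  linarith

/-! ## 4. The reduction with subsequence freedom -/

/-- **THE WEAKEST SAME-TRAJECTORY RESIDUAL of `CoerciveOfDilute` (subsequence freedom of the
`∃`-alignment).** Suppose that for every `N_f ∈ {2,3}`, every admissible regularisation `reg`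
(`HasMassScaling`, `HasAsymptoticScaling`) and all data `M₀ ≥ 0`, `b₀ ≥ 2`, `ℓ > 0` carrying the
BODY of `NegativeCellsDilute` (verbatim), there is a map `φ : ℕ → ℕ` tending to infinity (a
subsequence, chosen once) together with a threshold `M₁` and a window `ℓ₁ > 0` such that every mass
tuple `m > M₁` has `R, C`, an exponent `α > 0` and a level cap `t₀ > 0` with, eventually in `n`, on
every odd torus of physical side `≥ R` at step `k = φ n`, for every roughly cubic corner-`0` box with
`b₀ ≤ s_i ≤ 2S+1`, `s_i a_k ≤ ℓ₁`, every flavour and every `t ∈ (0, t₀]`: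
`P_pq(HasSingularSeparator U m_f(k) s (t/s₀)) ≤ C t^α`. THEN `CoerciveOfDilute`. Proof: the hinge is
witnessed by the SUBSEQUENCE regularisation `reg ∘ φ` (same `a, β, L, mcrit, Z_m` read at `φ n`),
which inherits `HasMassScaling`, `HasAsymptoticScaling`, `a → 0`, `a L → ∞` (`Tendsto.comp`) and the
clauses (ii), (iii) (`Tendsto.eventually` after `dilution_mono` / `pin_mono`), with threshold
`max M₀ M₁`, window `min ℓ ℓ₁`, size `max (max R₀ R) ℓ`; clause (i) is the hypothesis, extended from
`t ≤ t₀` to `t ≤ 1` by `P_pq ≤ 1` (`quenchedRatio_le_one`). With `φ = id` this is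
`coerciveOfDilute_of_separatorWegnerLaw`. [folklore] -/
theorem coerciveOfDilute_of_subseqWegnerLaw
    (hW : ∀ (Nf : ℕ) (reg : QCDRegularisation Nf), (Nf = 2 ∨ Nf = 3) → reg.HasMassScaling →
      (reg.scheme 0 0 0).HasAsymptoticScaling → ∀ M₀ : ℝ, 0 ≤ M₀ → ∀ b₀ : ℕ, 2 ≤ b₀ → ∀ ℓ : ℝ, 0 < ℓ →
      (∀ m : Fin Nf → ℝ, (∀ f, M₀ < m f) → ∃ R : ℝ, 0 < R ∧ (∀ ε : ℝ, 0 < ε → ∀ᶠ k : ℕ in Filter.atTop, ∀ S : ℕ, R ≤ reg.a k * (2 * S + 1) → let N : ℕ := 2 * S + 1; let mq : Fin Nf → ℝ := fun f => reg.mcrit k + reg.a k * m f / reg.Zm k; let wt : GaugeConfig 4 N (Matrix.specialUnitaryGroup (Fin 3) ℂ) → ℝ := fun U => ∏ f, ‖fermionDet (wilsonDirac (fundamentalRep (Fin 3)) U (mq f) 1)‖; let P : (GaugeConfig 4 N (Matrix.specialUnitaryGroup (Fin 3) ℂ) → Prop) → ℝ := fun E => (∫ U, (if E U then (1 : ℝ)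 else 0) * wt U ∂(wilsonMeasure (d := 4) (L := N) (fundamentalRep (Fin 3)) (reg.β k))) / (∫ U, wt U ∂(wilsonMeasure (d := 4) (L := N) (fundamentalRep (Fin 3)) (reg.β k))); let J : ℕ := Nat.log 2 (⌊ℓ / reg.a k⌋₊ / b₀) + 1; ∃ δ : ℕ → ℝ, ∑ j ∈ Finset.range J, δ j ≤ ε ∧ ∀ j < J, ∀ s : Fin 4 → ℕ, (∀ i, b₀ * 2 ^ j ≤ s i ∧ s i < b₀ * 2 ^ (j + 2) ∧ s i ≤ N ∧ (s i : ℝ) * reg.a k ≤ ℓ) → P (fun U => ∃ f, IsSignDefect U (mq f) j s) ≤ δ j) ∧ (∀ M : ℝ, M₀ < M → ∀ᶠ k : ℕ in Filter.atTop, ∀ S : ℕ, R ≤ reg.a k * (2 * S + 1) → let N : ℕ := 2 * S + 1; let mq : Fin Nf → ℝ := fun f => reg.mcrit k + reg.a k * m f / reg.Zm k; let wt : GaugeConfig 4 N (Matrix.specialUnitaryGroup (Fin 3) ℂ) → ℝ := fun U => ∏ f, ‖fermionDet (wilsonDirac (fundamentalRep (Fin 3)) U (mq f) 1)‖; (1 /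 4 : ℝ) ≤ (∫ U, (if (fermionDet (wilsonDirac (fundamentalRep (Fin 3)) U (reg.mcrit k - reg.a k * M / reg.Zm k) 1)).re < 0 then (1 : ℝ) else 0) * wt U ∂(wilsonMeasure (d := 4) (L := N) (fundamentalRep (Fin 3)) (reg.β k))) / (∫ U, wt U ∂(wilsonMeasure (d := 4) (L := N) (fundamentalRep (Fin 3)) (reg.β k))))) →
      ∃ φ : ℕ → ℕ, Filter.Tendsto φ Filter.atTop Filter.atTop ∧ ∃ M₁ ℓ₁ : ℝ, 0 < ℓ₁ ∧
        ∀ m : Fin Nf → ℝ, (∀ f, M₁ < m f) →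
        ∃ R C α t₀ : ℝ, 0 < α ∧ 0 < t₀ ∧ ∀ᶠ n : ℕ in Filter.atTop, ∀ S : ℕ,
          R ≤ reg.a (φ n) * (2 * S + 1) →
          let N : ℕ := 2 * S + 1
          let mq : Fin Nf → ℝ := fun f => reg.mcrit (φ n) + reg.a (φ n) * m f / reg.Zm (φ n)
          let wt : GaugeConfig 4 N (Matrix.specialUnitaryGroup (Fin 3) ℂ) → ℝ := fun U =>
            ∏ f, ‖fermionDet (wilsonDirac (fundamentalRep (Fin 3)) U (mq f) 1)‖
          let P : (GaugeConfig 4 N (Matrix.specialUnitaryGroup (Fin 3) ℂ) → Prop) → ℝ := fun E =>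
            (∫ U, (if E U then (1 : ℝ) else 0) * wt U
                ∂(wilsonMeasure (d := 4) (L := N) (fundamentalRep (Fin 3)) (reg.β (φ n)))) /
              (∫ U, wt U ∂(wilsonMeasure (d := 4) (L := N) (fundamentalRep (Fin 3)) (reg.β (φ n))))
          ∀ s : Fin 4 → ℕ, (∀ i, b₀ ≤ s i ∧ s i ≤ N ∧ (s i : ℝ) * reg.a (φ n) ≤ ℓ₁) →
            (∀ i j, s i ≤ 2 * s j) → ∀ f : Fin Nf, ∀ t : ℝ, 0 < t → t ≤ t₀ →
              P (fun U => HasSingularSeparator U (mq f) s (t / s 0)) ≤ C * t ^ α) :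
    CoerciveOfDilute := by
  intro hD Nf hNf
  obtain ⟨reg, hms, has, M₀, hM₀, b₀, hb₀, ℓ, hℓ, hm⟩ := hD Nf hNf
  obtain ⟨φ, hφ, M₁, ℓ₁, hℓ₁, hlaw⟩ := hW Nf reg hNf hms has M₀ hM₀ b₀ hb₀ ℓ hℓ hm
  -- the hinge is witnessed by the subsequence regularisation `reg ∘ φ`
  refine ⟨⟨fun n => reg.a (φ n), fun n => reg.a_pos (φ n), reg.tendsto_a.comp hφ,
      fun n => reg.β (φ n), fun n => reg.L (φ n), reg.tendsto_L.comp hφ, fun n => reg.mcrit (φ n),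
      fun n => reg.Zm (φ n), fun n => reg.Zm_pos (φ n)⟩, ?_, ?_, max M₀ M₁,
    hM₀.trans (le_max_left _ _), b₀, hb₀, min ℓ ℓ₁, lt_min hℓ hℓ₁, fun m hmm => ?_⟩
  · -- leading-log mass scaling passes to subsequences
    obtain ⟨c, hc, hlim⟩ := hms
    exact ⟨c, hc, hlim.comp hφ⟩
  · -- two-loop asymptotic scaling passes to subsequences
    obtain ⟨Λ, hΛ, hlim⟩ := has
    exact ⟨Λ, hΛ, hlim.comp hφ⟩
  have hm₀ : ∀ f, M₀ < m f := fun f => (le_max_left _ _).trans_lt (hmm f)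
  have hm₁ : ∀ f, M₁ < m f := fun f => (le_max_right _ _).trans_lt (hmm f)
  obtain ⟨R₀, hR₀, hDil, hPin⟩ := hm m hm₀
  obtain ⟨Rw, C, α, t₀, hα, ht₀, hlawk⟩ := hlaw m hm₁
  have hR' : R₀ ≤ max (max R₀ Rw) ℓ := (le_max_left _ _).trans (le_max_left _ _)
  refine ⟨max (max R₀ Rw) ℓ, hR₀.trans_le hR', ?_, ?_, ?_⟩
  · -- clause (i): the law along the subsequence, extended to all `t ∈ (0, 1]`
    have ht₀α : 0 < t₀ ^ α := Real.rpow_pos_of_pos ht₀ α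
    refine ⟨max C 0 + (t₀ ^ α)⁻¹, add_pos_of_nonneg_of_pos (le_max_right _ _) (inv_pos.mpr ht₀α),
      α, hα, ?_⟩
    filter_upwards [hlawk] with n hn
    intro S hS
    have hn' := hn S (((le_max_right _ _).trans (le_max_left _ _)).trans hS)
    dsimp only at hn' ⊢
    intro s hs hcub f t ht0 ht1
    have hs' : ∀ i, b₀ ≤ s i ∧ s i ≤ 2 * S + 1 ∧ (s i : ℝ) * reg.a (φ n) ≤ ℓ₁ := fun i =>
      ⟨(hs i).1, (hs i).2.1, (hs i).2.2.trans (min_le_right _ _)⟩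
    have htα : 0 ≤ t ^ α := (Real.rpow_pos_of_pos ht0 α).le
    have hC0 : 0 ≤ max C 0 := le_max_right _ _
    have hinv : 0 ≤ (t₀ ^ α)⁻¹ := (inv_pos.mpr ht₀α).le
    by_cases htt : t ≤ t₀
    · calc _ ≤ C * t ^ α := hn' s hs' hcub f t ht0 htt
        _ ≤ max C 0 * t ^ α := mul_le_mul_of_nonneg_right (le_max_left _ _) htα
        _ ≤ (max C 0 + (t₀ ^ α)⁻¹) * t ^ α := by nlinarith [mul_nonneg hinv htα]
    · have hpow : t₀ ^ α ≤ t ^ α := Real.rpow_le_rpow ht₀.le (not_le.mp htt).le hα.le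
      calc _ ≤ (1 : ℝ) :=
            quenchedRatio_le_one _ (fun U => Finset.prod_nonneg fun f _ => norm_nonneg _) _
        _ = (t₀ ^ α)⁻¹ * t₀ ^ α := (inv_mul_cancel₀ ht₀α.ne').symm
        _ ≤ (t₀ ^ α)⁻¹ * t ^ α := mul_le_mul_of_nonneg_left hpow hinv
        _ ≤ (max C 0 + (t₀ ^ α)⁻¹) * t ^ α := by nlinarith [mul_nonneg hC0 htα]
  · -- clause (ii): the hypothesis' dilution, moved to the smaller window, read along `φ`
    have h := dilution_mono reg hb₀ (lt_min hℓ hℓ₁) (min_le_left _ _) hR' (le_max_right _ _) m hDil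
    intro ε hε
    exact hφ.eventually (h ε hε)
  · -- clause (iii): the hypothesis' pin, restricted to larger `M₀` and `R`, read along `φ`
    intro M hM
    exact hφ.eventually (pin_mono hPin (le_max_left _ _) hR' M hM)

end Summit.QuantumFields.QCD.Theorems.NestedDissectionSeaCoerciveOfDilute

end
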